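import Summits.AtomisticToContinuum.BoseEinsteinCondensation.Theorems.BECCutLineWeakDisorderTaggedShiftTaggedCameronMartin
import Literature.MathematicalPhysics.QuantumManyBody.GroundStateFeynmanKacCutLine
import HarnessLib

/-!
# Route `BECCutLineWeakDisorder`, crux `TwoReplicaTransienceBound` (stmt-AtomisticToContinuum-9687),
# line `tagged-shift-log-harnack`: the ghost representation of the Feynman–Kac functional
# (change of measure on the tagged world-line; first half of the phantom identity (★))

Support file (lead a1). For the `(n+1)`-line killed, interaction-weighted system started at `X`,
the partition function `(e^{-TH}1)(X) = ∫ fkWeight v L T X ω dW(ω)` is rewritten, for every slope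
vector `a : Fin 3 → ℝ` and horizon `τ₀`, as the integral of the RAW Feynman–Kac weight of the
sample whose TAGGED Brownian coordinates are shifted by the ramps `u ↦ a_k min(u, τ₀)`, against
the Cameron–Martin density `∏_k exp(-a_k b_{τ₀} - a_k² τ₀/2)`:

  `(e^{-TH}1)(X) = ∫ taggedRampDensity (-a) τ₀ ω · rawFKWeight v L T (X, taggedRampShift a τ₀ (brownianPaths ω)) dW(ω)`

(`fkSemigroup_one_eq_lintegral_taggedRampShift`). With `X = (x″ + z) :: Y` and `a = -z/(√2 τ₀)`
the shifted tagged world-line is the GHOST `x″ + √2 b_s + (1 - s/τ₀)₊ z` (it starts at `x″ + z` and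
coincides with the real tagged line from `x″` after `τ₀`), and the density is
`ℛ_z = exp(z·b_{τ₀}/(√2τ₀) - |z|²/(4τ₀))`: this is the change-of-measure half of the phantom-window
identity (★) of LeadA1Report §2, EXACT for every measurable `v` (hard cores included) and every box —
in contrast with the card's identity (I), no path is lost: the raw weight of the ghost is evaluated on
ALL samples, including those whose real tagged line from the apex is killed inside the window.

* `rawWorldLine`, `rawFKWeight` — names for the raw (product-σ-algebra-measurable) world-line and
  Feynman–Kac weight of `GroundStateFeynmanKacSemigroup.lean` (there written inline);
  `rawFKWeight_brownianPaths : rawFKWeight v L t (Y, brownianPaths ω) = fkWeight v L t Y ω`.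
* `fkSemigroup_one_eq_lintegral_taggedRampShift` — the identity above (registered toolbox stub
  `stub_ghostRepresentation`).

References: Cameron–Martin (1944); B. Simon, *Functional Integration and Quantum Physics* (1979),
§V (Feynman–Kac with drifts). [folklore combination of the landed `stub_taggedCameronMartin` with
the raw-weight dictionary `rawWeight_pathsPath`]
-/

noncomputable section

open MeasureTheory Filter Set Finset
open scoped ENNReal NNReal Topology BigOperators

namespace Summit.AtomisticToContinuum.BoseEinsteinCondensation.Cruxes.TwoReplicaTransienceBound.TaggedShiftLogHarnack

open Literature.MathematicalPhysics.QuantumManyBody.BoseGas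
open Literature.Probability.Process

/-! ### The raw world-line and the raw Feynman–Kac weight -/

/-- The **raw world-line** of a starting configuration `Y` along raw paths `w` (product
σ-algebra on `PathSpace N`), at time `r`: `Y + √2 w̄(r)` with `w̄ = pathRegularize w`
coordinate-wise (`= Y + √2 w(r)` on continuous `w`, in particular on Brownian paths and on their
ramp shifts). [cite: ChungZhao1995, §3.3 (3.34)] -/
def rawWorldLine {N : ℕ} (p : Config N × PathSpace N) (r : ℝ≥0) : Config N :=
  fun i => p.1 i + WithLp.toLp 2 (fun k : Fin 3 => Real.sqrt 2 * pathRegularize (p.2 i k) r)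

/-- The **raw Feynman–Kac weight** `𝟙{raw survival on [0,t]} · e^{-∫₀ᵗ ∑_{i<j} v(raw world-line)}`
of a pair (start, raw paths) — the jointly measurable functional through which the Feynman–Kac
weight reads the Brownian paths (`rawFKWeight_brownianPaths`). [cite: ChungZhao1995, §3.3 (3.34)] -/
def rawFKWeight {N : ℕ} (v : ℝ → ℝ≥0∞) (L t : ℝ) (p : Config N × PathSpace N) : ℝ≥0∞ :=
  {q : Config N × PathSpace N | ∀ r ∈ Set.Icc (0 : ℝ) t, rawWorldLine q r.toNNReal ∈ boxN N L}.indicator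
    (fun q => expNeg (∫⁻ r in Set.Ioc (0 : ℝ) t, interaction v (rawWorldLine q r.toNNReal))) p

/-- The raw Feynman–Kac weight is jointly measurable in (start, raw paths). [folklore] -/
theorem measurable_rawFKWeight (N : ℕ) {v : ℝ → ℝ≥0∞} (hv : Measurable v) (L t : ℝ) :
    Measurable (rawFKWeight (N := N) v L t) :=
  measurable_rawWeight N hv L t

/-- **On the Brownian paths the raw weight is the Feynman–Kac weight**:
`rawFKWeight v L t (Y, brownianPaths ω) = fkWeight v L t Y ω`. [folklore] -/
theorem rawFKWeight_brownianPaths {N : ℕ} (v : ℝ → ℝ≥0∞) (L t : ℝ) (Y : Config N) (ω : PathSpace N) :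
    rawFKWeight v L t (Y, brownianPaths ω) = fkWeight v L t Y ω :=
  rawWeight_pathsPath v L t Y ω

/-- The raw weight is at most `1`. [folklore] -/
theorem rawFKWeight_le_one {N : ℕ} (v : ℝ → ℝ≥0∞) (L t : ℝ) (p : Config N × PathSpace N) :
    rawFKWeight v L t p ≤ 1 := by
  unfold rawFKWeight
  exact Set.indicator_apply_le' (fun _ => expNeg_le_one _) (fun _ => zero_le_one)

/-! ### The ghost representation -/

variable {n : ℕ}

/-- **Ghost representation of the Feynman–Kac functional** (registered toolbox stub
`stub_ghostRepresentation` is its `∀`-closed form). For every slope vector `a`, horizon `τ₀`,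
start `X` and every measurable pair potential `v`:
`(e^{-TH}1)(X) = ∫ taggedRampDensity (-a) τ₀ ω · rawFKWeight v L T (X, taggedRampShift a τ₀ (brownianPaths ω)) dW(ω)`
— Cameron–Martin for the tagged ramp (`stub_taggedCameronMartin`) applied to the raw weight times
the correction `∏_k exp(-a_k w_{0k}(τ₀) + a_k²τ₀/2)`, which is `1/density` on the Brownian paths and
the density of slope `-a` on the shifted ones. With `X = (x″+z) :: Y`, `a = -z/(√2τ₀)`: the
integrand is `ℛ_z ·` (weight of the GHOST system), LeadA1Report §2 (★). [folklore] -/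
theorem fkSemigroup_one_eq_lintegral_taggedRampShift {v : ℝ → ℝ≥0∞} (hv : Measurable v) (L T : ℝ)
    (a : Fin 3 → ℝ) (τ₀ : ℝ≥0) (X : Config (n + 1)) :
    fkSemigroup v L T (fun _ => (1 : ℝ≥0∞)) X =
      ∫⁻ ω, taggedRampDensity (fun k => -a k) τ₀ ω *
        rawFKWeight v L T (X, taggedRampShift a τ₀ (brownianPaths ω)) ∂wienerPaths (n + 1) := by
  -- the correction factor on raw paths
  set corr : PathSpace (n + 1) → ℝ≥0∞ := fun w =>
    ∏ k : Fin 3, ENNReal.ofReal (Real.exp (-a k * w 0 k τ₀ + a k ^ 2 * (τ₀ : ℝ) / 2)) with hcorr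
  have hcorr_m : Measurable corr := by
    refine Finset.measurable_prod _ fun k _ => ENNReal.measurable_ofReal.comp (Real.measurable_exp.comp ?_)
    have hev : Measurable fun w : PathSpace (n + 1) => w 0 k τ₀ :=
      (measurable_pi_apply τ₀).comp ((measurable_pi_apply k).comp
        (measurable_pi_apply (X := fun _ : Fin (n + 1) => Fin 3 → (ℝ≥0 → ℝ)) 0))
    exact (measurable_const.mul hev).add_const _
  -- the functional fed to Cameron–Martin
  set H : PathSpace (n + 1) → ℝ≥0∞ := fun w => rawFKWeight v L T (X, w) * corr w with hH
  have hHm : Measurable H :=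
    ((measurable_rawFKWeight (n + 1) hv L T).comp (measurable_const.prodMk measurable_id)).mul hcorr_m
  have hCM := stub_taggedCameronMartin n a τ₀ H hHm
  -- on Brownian paths: correction × density = 1
  have hone : ∀ ω : PathSpace (n + 1), corr (brownianPaths ω) * taggedRampDensity a τ₀ ω = 1 := by
    intro ω
    simp only [hcorr, taggedRampDensity, lineRampDensity, brownianPaths, ← Finset.prod_mul_distrib]
    refine Finset.prod_eq_one fun k _ => ?_
    rw [← ENNReal.ofReal_mul (Real.exp_pos _).le, ← Real.exp_add]
    have : -a k * brownian τ₀ (ω 0 k) + a k ^ 2 * (τ₀ : ℝ) / 2 +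
        (a k * brownian τ₀ (ω 0 k) - a k ^ 2 * (τ₀ : ℝ) / 2) = 0 := by ring
    rw [this, Real.exp_zero, ENNReal.ofReal_one]
  -- on shifted paths: correction = density of slope `-a`
  have hshift : ∀ ω : PathSpace (n + 1),
      corr (taggedRampShift a τ₀ (brownianPaths ω)) = taggedRampDensity (fun k => -a k) τ₀ ω := by
    intro ω
    simp only [hcorr, taggedRampDensity, lineRampDensity, taggedRampShift, brownianPaths, if_true,
      min_self]
    refine Finset.prod_congr rfl fun k _ => ?_
    congr 1
    congr 1
    ring
  -- assemble
  calc fkSemigroup v L T (fun _ => (1 : ℝ≥0∞)) X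
      = ∫⁻ ω, fkWeight v L T X ω ∂wienerPaths (n + 1) := by simp [fkSemigroup]
    _ = ∫⁻ ω, H (brownianPaths ω) * taggedRampDensity a τ₀ ω ∂wienerPaths (n + 1) := by
        refine lintegral_congr fun ω => ?_
        rw [hH]
        simp only
        rw [mul_assoc, hone ω, mul_one, rawFKWeight_brownianPaths]
    _ = ∫⁻ ω, H (taggedRampShift a τ₀ (brownianPaths ω)) ∂wienerPaths (n + 1) := hCM.symm
    _ = _ := by
        refine lintegral_congr fun ω => ?_
        rw [hH]
        simp only
        rw [hshift ω, mul_comm]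

/-- Registered toolbox stub `stub_ghostRepresentation` (lead a1): the ghost representation, all
particle numbers, potentials, boxes, polymer lengths, slopes, horizons and starts. -/
theorem stub_ghostRepresentation : ∀ (n : ℕ) (v : ℝ → ℝ≥0∞), Measurable v → ∀ (L T : ℝ)
    (a : Fin 3 → ℝ) (τ₀ : ℝ≥0) (X : Config (n + 1)),
      fkSemigroup v L T (fun _ => (1 : ℝ≥0∞)) X =
        ∫⁻ ω, taggedRampDensity (fun k => -a k) τ₀ ω *
          rawFKWeight v L T (X, taggedRampShift a τ₀ (brownianPaths ω)) ∂wienerPaths (n + 1) :=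
  fun _ _ hv L T a τ₀ X => fkSemigroup_one_eq_lintegral_taggedRampShift hv L T a τ₀ X

end Summit.AtomisticToContinuum.BoseEinsteinCondensation.Cruxes.TwoReplicaTransienceBound.TaggedShiftLogHarnack

end
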